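import Summits.QuantumFields.YangMills.Theorems.LangevinControlUVOSLegsFromFemtoAndGapDefs
import Literature.MathematicalPhysics.QuantumLattice.LatticeGaugeDLRFarFactorProofs
import Literature.MathematicalPhysics.QuantumFieldTheory.LatticeGaugeProofs

/-!
# Stub `stub_collar` of line `dlr-collar-transfer` (crux stmt-QuantumFields-9367): FBL ⇒ MomentBounds

`Summit.QuantumFields.YangMills.Cruxes.OSLegsFromFemtoAndGap.DlrCollarTransfer.stub_collar : Statement.stub_collar`,
i.e. for every compact `G`, lattice representation `r` and unit map `a`, `FBL G r a → MomentBounds G r a`: the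
frozen-boundary femto law for the action density (kernel means at depth `d` are within `C₁/d⁴` of `p β`, for EVERY
exterior) transfers to `(2C₁/R⁴)ⁿ` bounds on the centred `n`-th moments of the action densities at pairwise
torus-separated sites, on EVERY odd torus `(ℤ/(2L+1))⁴` with `4R+8 ≤ L`.

Proof: instantiate the tree's `abs_integral_prod_sub_mean_le` (`LatticeGaugeDLRFarFactorProofs.lean`: one torus DLR
step per site with the other factors as far factor, sup bounds) with the volumes `Λᵢ = cubeEdges (xᵢ − (R+1)) (2R+3)`
(the radius-`R+1` cube centred at `xᵢ`, centre depth `R+2`) and the observables `Aᵢ = dens (xᵢ)`; the geometric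
side conditions (each `Λᵢ ∪ supp Aᵢ ∪ ∂Λᵢ` lies in the radius-`R+2` sup-ball around `xᵢ`, which injects into the torus
since `2R+4 < 2L+1`, and the balls of radius `R+2` around `xⱼ` and `R+1` around `xᵢ` are disjoint on the torus by the
separation hypothesis `2R+4 ≤ |xᵢ k − xⱼ k|_{torus}`) are §1; FBL at depth `R+2` gives `ε = C₁/(R+2)⁴ ≤ C₁/R⁴` (§2).
Constants: `C = 2C₁`, `β₄ = β₁`, `ℓ₄ = ℓ₁/5` (`(2R+3)·a β ≤ 5R·a β ≤ ℓ₁` when `a β ≥ 0`, trivial otherwise).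
-/

set_option autoImplicit false

noncomputable section

open scoped SchwartzMap
open MeasureTheory Filter Topology
open Literature.MathematicalPhysics.QuantumFieldTheory Literature.MathematicalPhysics.QuantumLattice
open Literature.MathematicalPhysics.AQFT Literature.Probability.LatticeModels

namespace Summit.QuantumFields.YangMills.Cruxes.OSLegsFromFemtoAndGap.DlrCollarTransfer

/-! ## §1 Geometry of the centred cubes and of the action density -/

section CubeGeometry

/-- Sites of the cube of side `2R+3` based at `x − (R+1)` lie within sup-distance `R+1` of `x`. [folklore] -/
theorem near_of_mem_cubeSites_centred {x y : Fin 4 → ℤ} {R : ℕ}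
    (hy : y ∈ cubeSites (fun k => x k - (R + 1)) (2 * R + 3)) (j : Fin 4) : |y j - x j| ≤ (R : ℤ) + 1 := by
  have h := Fintype.mem_piFinset.1 hy j
  rw [Finset.mem_Ico] at h
  rw [abs_le]
  push_cast at h
  constructor <;> linarith [h.1, h.2]

/-- Interior links of a cube are based at cube sites. [folklore] -/
theorem fst_mem_cubeSites_of_mem_cubeEdges {c : Fin 4 → ℤ} {b : ℕ}
    {e : Literature.MathematicalPhysics.QuantumLattice.ZdEdge 4} (he : e ∈ cubeEdges c b) : e.1 ∈ cubeSites c b := by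
  unfold cubeEdges at he
  exact (Finset.mem_product.1 (Finset.mem_filter.1 he).1).1

/-- The centre of the cube of side `2R+3` based at `x − (R+1)` has depth `R+2`. [folklore] -/
theorem depth_centred (x : Fin 4 → ℤ) (R : ℕ) : depth (fun k => x k - (R + 1)) (2 * R + 3) x = R + 2 := by
  unfold depth
  have key : ∀ j : Fin 4, min (x j - (x j - ((R : ℤ) + 1)) + 1).toNat
      (x j - ((R : ℤ) + 1) + ((2 * R + 3 : ℕ) : ℤ) - x j).toNat = R + 2 := by
    intro j
    have e1 : x j - (x j - ((R : ℤ) + 1)) + 1 = ((R + 2 : ℕ) : ℤ) := by push_cast; ring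
    have e2 : x j - ((R : ℤ) + 1) + ((2 * R + 3 : ℕ) : ℤ) - x j = ((R + 2 : ℕ) : ℤ) := by push_cast; ring
    rw [e1, e2, Int.toNat_natCast, min_self]
  simp only [key]
  exact Finset.inf'_const _ _

/-- Edges of plaquettes touching the cube of side `2R+3` based at `x − (R+1)` lie within sup-distance `R+2` of `x`.
[folklore] -/
theorem near_of_mem_boundary_centred {x : Fin 4 → ℤ} {R : ℕ}
    {e : Literature.MathematicalPhysics.QuantumLattice.ZdEdge 4}
    (he : e ∈ (plaquettesTouching (cubeEdges (fun k => x k - (R + 1)) (2 * R + 3))).biUnion plaquetteEdges)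
    (j : Fin 4) : |e.1 j - x j| ≤ (R : ℤ) + 2 := by
  obtain ⟨e₀, he₀, hnear⟩ := exists_near_of_mem_plaquettesTouching_biUnion he
  have h0 := near_of_mem_cubeSites_centred (fst_mem_cubeSites_of_mem_cubeEdges he₀) j
  have h1 := abs_sub_le (e.1 j) (e₀.1 j) (x j)
  linarith [hnear j]

variable {G : Type} [Group G] [TopologicalSpace G] [IsTopologicalGroup G] [CompactSpace G]
  [MeasurableSpace G] [BorelSpace G] (r : LatticeRep G)

/-- The action density at `x` is continuous. [folklore] -/
theorem continuous_dens (x : Fin 4 → ℤ) : Continuous (dens G r x) :=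
  (continuous_actionDensity r.continuous).comp (continuous_configShift (-x))

/-- The action density at `x` is a cylinder observable on the translate by `x` of the curvature support. [folklore] -/
theorem isCylinder_dens (x : Fin 4 → ℤ) :
    IsCylinder (dens G r x) (r.curvature.supp.image fun e => (e.1 - -x, e.2)) :=
  IsCylinder.comp_configShift r.curvature.isCylinder (-x)

/-- The support of the action density at `x` is based at sites `y` with `0 ≤ y − x ≤ 1` coordinatewise. [folklore] -/
theorem near_of_mem_supp_dens {x : Fin 4 → ℤ} {e : Literature.MathematicalPhysics.QuantumLattice.ZdEdge 4}
    (he : e ∈ r.curvature.supp.image fun e => (e.1 - -x, e.2)) (j : Fin 4) :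
    0 ≤ e.1 j - x j ∧ e.1 j - x j ≤ 1 := by
  obtain ⟨e', he', rfl⟩ := Finset.mem_image.1 he
  change e' ∈ Finset.univ.biUnion (fun p : Fin 4 × Fin 4 => originPlaquetteSupport p.1 p.2) at he'
  obtain ⟨p, -, hp⟩ := Finset.mem_biUnion.1 he'
  simp only [originPlaquetteSupport, Finset.mem_insert, Finset.mem_singleton] at hp
  simp only [sub_neg_eq_add, Pi.add_apply, add_sub_cancel_right]
  rcases hp with rfl | rfl | rfl | rfl <;> simp [Pi.single_apply] <;> split_ifs <;> simp

/-- For `R ≥ 1` the action density at `x` is a cylinder observable on the interior links of the cube of side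
`2R+3` based at `x − (R+1)` (its support is based at `x`, `x + eᵢ`, with both endpoints in `x + [0, 2]⁴`). [folklore] -/
theorem isCylinder_dens_cube {R : ℕ} (hR : 1 ≤ R) (x : Fin 4 → ℤ) :
    IsCylinder (dens G r x) (cubeEdges (fun k => x k - (R + 1)) (2 * R + 3)) := by
  refine (isCylinder_dens r x).mono (Finset.coe_subset.2 fun e he => ?_)
  have h01 := near_of_mem_supp_dens r he
  unfold cubeEdges cubeSites
  simp only [Finset.mem_filter, Finset.mem_product, Finset.mem_univ, and_true, Fintype.mem_piFinset,
    Finset.mem_Ico, Pi.add_apply, Pi.single_apply]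
  refine ⟨fun j => ?_, fun j => ?_⟩
  · obtain ⟨h0, h1⟩ := h01 j
    push_cast
    constructor <;> omega
  · obtain ⟨h0, h1⟩ := h01 j
    split_ifs <;> push_cast <;> constructor <;> omega

/-- **Injectivity side condition** of the DLR step at a site: the cube of radius `R+1` around `x` and the edges of
the plaquettes touching it lie in the sup-ball of radius `R+2` around `x`, on which reduction mod `2L+1` is
injective when `4R+8 ≤ L`. [folklore] -/
theorem injOn_torusProj_cube {L R : ℕ} (hRL : 4 * R + 8 ≤ L) (x : Fin 4 → ℤ) :
    Set.InjOn (Torus.proj (2 * L + 1))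
      (((cubeEdges (fun k => x k - (R + 1)) (2 * R + 3) ∪ cubeEdges (fun k => x k - (R + 1)) (2 * R + 3) ∪
          (plaquettesTouching (cubeEdges (fun k => x k - (R + 1)) (2 * R + 3))).biUnion plaquetteEdges).image
          Prod.fst : Set (Fin 4 → ℤ))) := by
  refine (injOn_torusProj_of_near (M := 2 * L + 1) x (ϱ := (R : ℤ) + 2) (by push_cast; omega)).mono ?_
  intro y hy
  obtain ⟨e, he, rfl⟩ := Finset.mem_image.1 (Finset.mem_coe.1 hy)
  simp only [Set.mem_setOf_eq]
  rcases Finset.mem_union.1 he with he | he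
  · rw [Finset.union_idempotent] at he
    exact fun j => (near_of_mem_cubeSites_centred (fst_mem_cubeSites_of_mem_cubeEdges he) j).trans (by linarith)
  · exact near_of_mem_boundary_centred he

/-- **Separation side condition**: if `x` and `x'` are at torus distance `≥ 2R+4` in some coordinate, then the
cube of radius `R+1` around `x'` and the boundary edges of that cube (radius `R+2` around `x'`) do not meet the
cube of radius `R+1` around `x` on the torus `(ℤ/(2L+1))⁴`. [folklore] -/
theorem torusEdge_ne_cube {L R : ℕ} {x x' : Fin 4 → ℤ}
    (hsep : ∃ k : Fin 4, (2 * (R : ℤ) + 4) ≤ |((((x k - x' k : ℤ) : ZMod (2 * L + 1))).valMinAbs : ℤ)|)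
    {e e' : Literature.MathematicalPhysics.QuantumLattice.ZdEdge 4}
    (he : e ∈ cubeEdges (fun k => x' k - (R + 1)) (2 * R + 3) ∪
      (plaquettesTouching (cubeEdges (fun k => x' k - (R + 1)) (2 * R + 3))).biUnion plaquetteEdges)
    (he' : e' ∈ cubeEdges (fun k => x k - (R + 1)) (2 * R + 3)) :
    torusEdge (2 * L + 1) e ≠ torusEdge (2 * L + 1) e' := by
  obtain ⟨k, hk⟩ := hsep
  have hnear : ∀ j, |e.1 j - x' j| ≤ (R : ℤ) + 2 := by
    rcases Finset.mem_union.1 he with h | h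
    · exact fun j => (near_of_mem_cubeSites_centred (fst_mem_cubeSites_of_mem_cubeEdges h) j).trans (by linarith)
    · exact near_of_mem_boundary_centred h
  have hnear' : ∀ j, |e'.1 j - x j| ≤ (R : ℤ) + 1 := fun j =>
    near_of_mem_cubeSites_centred (fst_mem_cubeSites_of_mem_cubeEdges he') j
  exact torusEdge_ne_of_separated (ϱ := (R : ℤ) + 1) (ϱ' := (R : ℤ) + 2) (by linarith) hnear hnear'

end CubeGeometry

/-! ## §2 FBL at the centre of the cube; the stub -/

section Transfer

variable {G : Type} [Group G] [TopologicalSpace G] [IsTopologicalGroup G] [CompactSpace G]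
  [MeasurableSpace G] [BorelSpace G] (r : LatticeRep G)

/-- FBL at the centre (depth `R+2`) of the cube of side `2R+3` around `x`: the kernel mean of the action density
at `x` is within `C₁/R⁴` of `p`, for every exterior. [folklore] -/
theorem abs_kerE_dens_centred_sub_le {aβ C₁ ℓ₁ β pβ : ℝ} (hC₁ : 0 ≤ C₁)
    (hF : ∀ (c : Fin 4 → ℤ) (b : ℕ), (b : ℝ) * aβ ≤ ℓ₁ → ∀ (η : LGConfig 4 G) (x : Fin 4 → ℤ),
      2 ≤ depth c b x → |kerE G r β c b η (dens G r x) - pβ| ≤ C₁ / (depth c b x : ℝ) ^ 4)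
    {R : ℕ} (hR : 1 ≤ R) (hb : ((2 * R + 3 : ℕ) : ℝ) * aβ ≤ ℓ₁) (x : Fin 4 → ℤ) (η : LGConfig 4 G) :
    |kerE G r β (fun k => x k - (R + 1)) (2 * R + 3) η (dens G r x) - pβ| ≤ C₁ / (R : ℝ) ^ 4 := by
  have hd := depth_centred x R
  have h1 := hF (fun k => x k - (R + 1)) (2 * R + 3) hb η x (by rw [hd]; omega)
  rw [hd] at h1
  refine h1.trans ?_
  have hR' : (0 : ℝ) < R := Nat.cast_pos.2 hR
  push_cast
  refine div_le_div_of_nonneg_left hC₁ (pow_pos hR' 4) ?_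
  gcongr
  linarith

/-- Registered stub `stub_collar` (CollarTransfer): `FBL G r a → MomentBounds G r a` for every compact `G`, lattice
representation `r` and unit map `a` — the frozen-boundary femto law collars to `(2C₁/R⁴)ⁿ` centred-moment bounds on
every odd torus, by one torus DLR step per site (tree `abs_integral_prod_sub_mean_le`) on the radius-`R+1` cubes
around the sites. [folklore] -/
theorem stub_collar : Statement.stub_collar := by
  intro G _ _ _ _ _ _ r a hFBL
  obtain ⟨C₁, β₁, ℓ₁, p, hℓ₁, hC₁, hF⟩ := hFBL
  refine ⟨2 * C₁, β₁, ℓ₁ / 5, by positivity, by positivity, ?_⟩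
  intro β hβ L n x R hR hRa hRL hsep
  haveI : SecondCountableTopology G :=
    (r.continuous.isClosedEmbedding r.injective).isEmbedding.secondCountableTopology
  obtain ⟨CA, hCA⟩ := r.curvature.bounded
  -- the cubes of side `2R+3` are femto cubes
  have hb : ((2 * R + 3 : ℕ) : ℝ) * a β ≤ ℓ₁ := by
    rcases le_or_gt 0 (a β) with ha | ha
    · have h5 : ((2 * R + 3 : ℕ) : ℝ) ≤ 5 * R := by
        have : (1 : ℝ) ≤ R := by exact_mod_cast hR
        push_cast
        linarith
      calc ((2 * R + 3 : ℕ) : ℝ) * a β ≤ 5 * R * a β := mul_le_mul_of_nonneg_right h5 ha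
        _ = 5 * ((R : ℝ) * a β) := by ring
        _ ≤ 5 * (ℓ₁ / 5) := by gcongr
        _ = ℓ₁ := by ring
    · have : ((2 * R + 3 : ℕ) : ℝ) * a β ≤ 0 := mul_nonpos_of_nonneg_of_nonpos (by positivity) ha.le
      linarith
  -- the data of the abstract collar bound (tree `abs_integral_prod_sub_mean_le`): volumes = supports = the cubes
  have hAc : ∀ i : Fin n, Continuous (dens G r (x i)) := fun i => continuous_dens r (x i)
  have hAb : ∀ (i : Fin n) (U : LGConfig 4 G), |dens G r (x i) U| ≤ CA := fun i U => hCA _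
  have hAS : ∀ i : Fin n, IsCylinder (dens G r (x i)) (cubeEdges (fun k => x i k - (R + 1)) (2 * R + 3)) :=
    fun i => isCylinder_dens_cube r hR (x i)
  have hinj : ∀ i : Fin n, Set.InjOn (Torus.proj (2 * L + 1))
      (((cubeEdges (fun k => x i k - (R + 1)) (2 * R + 3) ∪ cubeEdges (fun k => x i k - (R + 1)) (2 * R + 3) ∪
          (plaquettesTouching (cubeEdges (fun k => x i k - (R + 1)) (2 * R + 3))).biUnion plaquetteEdges).image
          Prod.fst : Set (Fin 4 → ℤ))) := fun i => injOn_torusProj_cube hRL (x i)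
  have hfar : ∀ i j : Fin n, i ≠ j → ∀ e ∈ cubeEdges (fun k => x j k - (R + 1)) (2 * R + 3) ∪
      (plaquettesTouching (cubeEdges (fun k => x j k - (R + 1)) (2 * R + 3))).biUnion plaquetteEdges,
      ∀ e' ∈ cubeEdges (fun k => x i k - (R + 1)) (2 * R + 3),
      torusEdge (2 * L + 1) e ≠ torusEdge (2 * L + 1) e' :=
    fun i j hij e he e' he' => torusEdge_ne_cube (hsep i j hij) he he'
  have hm : ∀ i : Fin n, torusE G r β L (dens G r (x i)) =
      ∫ W, dens G r (x i) (torusLift (2 * L + 1) W) ∂(wilsonMeasure r.ρ β) := fun i => rfl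
  have hker : ∀ (i : Fin n) (η : LGConfig 4 G), |(∫ U, dens G r (x i) U ∂(ymSpecification r.ρ β
      (cubeEdges (fun k => x i k - (R + 1)) (2 * R + 3)) η)) - p β| ≤ C₁ / (R : ℝ) ^ 4 :=
    fun i η => abs_kerE_dens_centred_sub_le r hC₁ (hF β hβ) hR hb (x i) η
  have key := abs_integral_prod_sub_mean_le (d := 4) r.ρ r.continuous β (L := 2 * L + 1) (n := n)
    (fun i => cubeEdges (fun k => x i k - (R + 1)) (2 * R + 3))
    (fun i => cubeEdges (fun k => x i k - (R + 1)) (2 * R + 3))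
    (fun i => dens G r (x i)) hAc hAb hAS hinj hfar (fun i => torusE G r β L (dens G r (x i))) hm hker
  rw [show (2 : ℝ) * (C₁ / (R : ℝ) ^ 4) = 2 * C₁ / (R : ℝ) ^ 4 from (mul_div_assoc _ _ _).symm] at key
  exact key

end Transfer

end Summit.QuantumFields.YangMills.Cruxes.OSLegsFromFemtoAndGap.DlrCollarTransfer

end
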